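/-
COR-CM (cell pub-hodgecm2, stage 2 of the Hodge ladder) — count-neutral KERNEL COMBINATORICS «quartic Aut-data of the named cyclotomic fields ℚ(ζ₆₅), ℚ(ζ₈₅)»
(seat prover-pub-hodgecm2-b23-g41-0, binder prover b23, gen 41; claim QUARTIC-TRANSPORT F5a, HOME/INBOX.md l.10098; blanket `CorCM/FaceQuarticTwist*` l.10129).
Theorems only; the unit tables are checked by `decide +kernel` (kernel reduction, no `native_decide`, no extra axiom); `CorCM/FaceAbelianDatum.lean`
(`FaceAbelian.autEquivPow_conjAut`: complex conjugation = `−1 ∈ (ℤ/N)ˣ`) and `FaceCensus.exists_conjAut` used BY NAME; no geometry, no named fact, nothing asserted;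
`Interfaces.lean` (C1), every E term, B01, `Transposition/*`, `PortJoin/*` untouched.
HONEST FRAMING: `HC_CM` is NOT proved, here or anywhere in the tree; nothing here is a period, a count of record or a headline.
T5: n/a-class (no Prop hypothesis binder beyond `[IsCyclotomicExtension {N} ℚ K]` and the unit-table equations); checker: self, 2026-08-23.
-/
import Summits.HodgeConjecture.CorCM.FaceAbelianDatum

/-!
# Quartic `Aut`-data for cyclotomic fields: `ℚ(ζ₆₅)` over `ℤ/12` and `ℚ(ζ₈₅)` over `ℤ/16` (both with a screw)

A Galois CM field `F` is of QUARTIC-TWIST type over `B` (seat b09's `Census/QuarticTwist*`, this seat's `Census/ClockTypes*` /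
`CorCM/FaceQuarticTwistGeneration.lean`) when `Aut(F) ≅ ℤ/4 × B` with complex conjugation `↦ (2, 0)`.  For `F = ℚ(ζ_N)`, `Aut(F) ≅ (ℤ/N)ˣ`
(`IsCyclotomicExtension.autEquivPow`) with conjugation `= −1` (`FaceAbelian.autEquivPow_conjAut`), so a quartic `Aut`-datum is a bijective
**quartic unit table** `t : (ℤ/N)ˣ → ℤ/4 × B`, additive on products, with `t(−1) = (2, 0)` (§1, `exists_quarticAutDatum_of_unitTable`).
`−1` is a square mod `N` exactly when `4 ∤ N` and every odd prime factor of `N` is `≡ 1 (mod 4)`; the two smallest non-cyclic cases are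

* §2 **`N = 65`**: `(ℤ/65)ˣ ≅ (ℤ/5)ˣ × (ℤ/13)ˣ ≅ ℤ/4 × ℤ/12`, `−1 ↦ (2, 6)`; the table `u ↦ (log₂(u mod 5), log₂(u mod 13) − 3·log₂(u mod 5))` (the shear
  `(a, b) ↦ (a, b − 3a)` of `ℤ/4 × ℤ/12` moves `(2, 6)` to `(2, 0)`) is a quartic unit table over `B = ℤ/12` (`exists_quarticUnitTable_sixtyFive`), and
  `B = ℤ/12` HAS an element of order divisible by `4` (`exists_four_dvd_addOrderOf_zmod_twelve`) — the SCREW case of seat b09's law: once F4 lands,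
  `ℚ(ζ₆₅)` (degree `48`) has EXACTLY `β − 2` generating rank-four faces;
* §3 **`N = 85`**: `(ℤ/85)ˣ ≅ ℤ/4 × ℤ/16`, table `u ↦ (log₂(u mod 5), log₃(u mod 17) − 4·log₂(u mod 5))`, `B = ℤ/16` (screw; degree `64`, `β − 2`).

(NO cyclotomic field is a no-screw quartic twist: every factor `(ℤ/p^k)ˣ` with `p ≡ 1 (mod 4)` has order divisible by `4`; the `β − 1` fields of the law are the
`k₄·L` with `Gal(L/ℚ)` free of elements of order divisible by `4`.)  The field-level corollaries (face counts, HC socket) follow by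
`FaceQuarticTwist.isLeast_card_faces_hgen_of_quartic_aut` / `hodgeConjectureFor_of_quartic_aut_of_exists_facePeriod` once that file is in the tree.

## References
* [Washington1997] L. C. Washington, Introduction to Cyclotomic Fields, 2nd ed., GTM 83, Springer 1997, Thm. 2.5 (`Gal(ℚ(ζ_N)/ℚ) ≅ (ℤ/N)ˣ`).
-/

noncomputable section

open NumberField NumberField.ComplexEmbedding

namespace Summit.HodgeConjecture.CorCM.FaceQuarticTwist

/-! ## §1 Quartic `Aut`-data from quartic unit tables -/

section Generic

variable {K : Type} [Field K] [NumberField K] {N : ℕ} [NeZero N] {B : Type} [AddGroup B]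

/-- **A quartic unit table gives a quartic `Aut`-datum on `ℚ(ζ_N)`.**  For `t : (ℤ/N)ˣ → ℤ/4 × B` bijective, additive on products, with
`t (−1) = (2, 0)`: for every complex embedding `σ₀` there are the conjugation automorphism `c` at `σ₀` and a bijection `ε : Aut(K) ≃ ℤ/4 × B`,
multiplicative-to-additive, with `ε c = (2, 0)` — the input of `FaceQuarticTwist.isLeast_card_faces_hgen_of_quartic_aut`. [cite: Washington1997, Thm. 2.5] -/
theorem exists_quarticAutDatum_of_unitTable [IsCyclotomicExtension {N} ℚ K] (t : (ZMod N)ˣ → ZMod 4 × B)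
    (ht : ∀ u v, t (u * v) = t u + t v) (ht1 : t (-1) = (2, 0)) (htb : Function.Bijective t) (σ₀ : K →+* ℂ) :
    ∃ (c : K ≃ₐ[ℚ] K) (ε : (K ≃ₐ[ℚ] K) ≃ ZMod 4 × B), σ₀.comp (c : K →+* K) = conjugate σ₀ ∧
      (∀ g h, ε (g * h) = ε g + ε h) ∧ ε c = (2, 0) := by
  haveI := IsCyclotomicExtension.isGalois {N} ℚ K
  obtain ⟨c, hcσ⟩ := FaceCensus.exists_conjAut σ₀
  let e := IsCyclotomicExtension.autEquivPow K (Polynomial.cyclotomic.irreducible_rat (NeZero.pos N))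
  refine ⟨c, e.toEquiv.trans (Equiv.ofBijective t htb), hcσ, fun g h => ?_, ?_⟩
  · show t (e (g * h)) = t (e g) + t (e h)
    rw [map_mul, ht]
  · show t (e c) = (2, 0)
    rw [FaceAbelian.autEquivPow_conjAut σ₀ hcσ, ht1]

end Generic

/-! ## §2 `ℚ(ζ₆₅)`: `(ℤ/65)ˣ ≅ ℤ/4 × ℤ/12`, `−1 ↦ (2, 0)`, with a screw -/

/-- **The quartic unit table of `65`** (CRT + discrete logarithms base `2` mod `5` and mod `13`, sheared by `(a, b) ↦ (a, b − 3a)`): bijective onto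
`ℤ/4 × ℤ/12`, additive on products, `−1 ↦ (2, 0)`; checked by kernel `decide`. [folklore] -/
theorem exists_quarticUnitTable_sixtyFive :
    ∃ t : (ZMod 65)ˣ → ZMod 4 × ZMod 12, (∀ u v, t (u * v) = t u + t v) ∧ t (-1) = (2, 0) ∧ Function.Bijective t :=
  ⟨fun u : (ZMod 65)ˣ =>
      (if (u : ZMod 65).val % 5 = 2 then (1 : ZMod 4) else if (u : ZMod 65).val % 5 = 4 then (2 : ZMod 4) else if (u : ZMod 65).val % 5 = 3 then (3 : ZMod 4) else 0,
        (if (u : ZMod 65).val % 13 = 2 then (1 : ZMod 12) else if (u : ZMod 65).val % 13 = 4 then (2 : ZMod 12) else if (u : ZMod 65).val % 13 = 8 then (3 : ZMod 12) else if (u : ZMod 65).val % 13 = 3 then (4 : ZMod 12) else if (u : ZMod 65).val % 13 = 6 then (5 : ZMod 12) else if (u : ZMod 65).val % 13 = 12 then (6 : ZMod 12) else if (u : ZMod 65).val % 13 = 11 then (7 : ZMod 12) else if (u : ZMod 65).val % 13 = 9 then (8 : ZMod 12) else if (u : ZMod 65).val % 13 = 5 then (9 : ZMod 12) else if (u : ZMod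 65).val % 13 = 10 then (10 : ZMod 12) else if (u : ZMod 65).val % 13 = 7 then (11 : ZMod 12) else 0) -
        (if (u : ZMod 65).val % 5 = 2 then (3 : ZMod 12) else if (u : ZMod 65).val % 5 = 4 then (6 : ZMod 12) else if (u : ZMod 65).val % 5 = 3 then (9 : ZMod 12) else 0)),
    by decide +kernel, by decide +kernel, by decide +kernel⟩

/-- `ℤ/12` has an element of additive order divisible by `4` (the class of `3`): the SCREW case. [folklore] -/
theorem exists_four_dvd_addOrderOf_zmod_twelve : ∃ t : ZMod 12, 4 ∣ addOrderOf t :=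
  ⟨((3 : ℕ) : ZMod 12), by rw [ZMod.addOrderOf_coe 3 (by norm_num)]; decide⟩

/-- `|ℤ/12| ≥ 3`. [folklore] -/
theorem three_le_card_zmod_twelve : 3 ≤ Fintype.card (ZMod 12) := by
  rw [ZMod.card]; norm_num

/-- **`ℚ(ζ₆₅)` carries a quartic `Aut`-datum over `B = ℤ/12`**: for `K` ANY `65`-th cyclotomic extension of `ℚ` and any complex embedding `σ₀`, the
conjugation automorphism `c` at `σ₀` and a bijection `ε : Aut(K) ≃ ℤ/4 × ℤ/12`, multiplicative-to-additive, with `ε c = (2, 0)`. [cite: Washington1997, Thm. 2.5] -/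
theorem exists_quarticAutDatum_cyclotomic_sixtyFive (K : Type) [Field K] [NumberField K] [IsCyclotomicExtension {65} ℚ K] (σ₀ : K →+* ℂ) :
    ∃ (c : K ≃ₐ[ℚ] K) (ε : (K ≃ₐ[ℚ] K) ≃ ZMod 4 × ZMod 12), σ₀.comp (c : K →+* K) = conjugate σ₀ ∧
      (∀ g h, ε (g * h) = ε g + ε h) ∧ ε c = (2, 0) := by
  obtain ⟨t, ht, ht1, htb⟩ := exists_quarticUnitTable_sixtyFive
  exact exists_quarticAutDatum_of_unitTable t ht ht1 htb σ₀

/-! ## §3 `ℚ(ζ₈₅)`: `(ℤ/85)ˣ ≅ ℤ/4 × ℤ/16`, `−1 ↦ (2, 0)`, with a screw -/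

/-- **The quartic unit table of `85`** (discrete logarithms base `2` mod `5`, base `3` mod `17`, shear `(a, b) ↦ (a, b − 4a)`): bijective onto
`ℤ/4 × ℤ/16`, additive on products, `−1 ↦ (2, 0)`; checked by kernel `decide`. [folklore] -/
theorem exists_quarticUnitTable_eightyFive :
    ∃ t : (ZMod 85)ˣ → ZMod 4 × ZMod 16, (∀ u v, t (u * v) = t u + t v) ∧ t (-1) = (2, 0) ∧ Function.Bijective t :=
  ⟨fun u : (ZMod 85)ˣ =>
      (if (u : ZMod 85).val % 5 = 2 then (1 : ZMod 4) else if (u : ZMod 85).val % 5 = 4 then (2 : ZMod 4) else if (u : ZMod 85).val % 5 = 3 then (3 : ZMod 4) else 0,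
        (if (u : ZMod 85).val % 17 = 3 then (1 : ZMod 16) else if (u : ZMod 85).val % 17 = 9 then (2 : ZMod 16) else if (u : ZMod 85).val % 17 = 10 then (3 : ZMod 16) else if (u : ZMod 85).val % 17 = 13 then (4 : ZMod 16) else if (u : ZMod 85).val % 17 = 5 then (5 : ZMod 16) else if (u : ZMod 85).val % 17 = 15 then (6 : ZMod 16) else if (u : ZMod 85).val % 17 = 11 then (7 : ZMod 16) else if (u : ZMod 85).val % 17 = 16 then (8 : ZMod 16) else if (u : ZMod 85).val % 17 = 14 then (9 : ZMod 16) else if (u : ZMod 85).val % 17 = 8 then (10 : ZMod 16) else if (u : ZMod 85).val % 17 = 7 then (11 : ZMod 16) else if (u : ZMod 85).val % 17 = 4 then (12 : ZMod 16) else if (u : ZMod 85).val % 17 = 12 then (13 : ZMod 16) else if (u : ZMod 85).val % 17 = 2 then (14 : ZMod 16) else if (u : ZMod 85).val % 17 = 6 then (15 : ZMod 16) else 0) -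
        (if (u : ZMod 85).val % 5 = 2 then (4 : ZMod 16) else if (u : ZMod 85).val % 5 = 4 then (8 : ZMod 16) else if (u : ZMod 85).val % 5 = 3 then (12 : ZMod 16) else 0)),
    by decide +kernel, by decide +kernel, by decide +kernel⟩

/-- `ℤ/16` has an element of additive order divisible by `4` (the class of `4`). [folklore] -/
theorem exists_four_dvd_addOrderOf_zmod_sixteen : ∃ t : ZMod 16, 4 ∣ addOrderOf t :=
  ⟨((4 : ℕ) : ZMod 16), by rw [ZMod.addOrderOf_coe 4 (by norm_num)]; decide⟩

/-- `|ℤ/16| ≥ 3`. [folklore] -/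
theorem three_le_card_zmod_sixteen : 3 ≤ Fintype.card (ZMod 16) := by
  rw [ZMod.card]; norm_num

/-- **`ℚ(ζ₈₅)` carries a quartic `Aut`-datum over `B = ℤ/16`.** [cite: Washington1997, Thm. 2.5] -/
theorem exists_quarticAutDatum_cyclotomic_eightyFive (K : Type) [Field K] [NumberField K] [IsCyclotomicExtension {85} ℚ K] (σ₀ : K →+* ℂ) :
    ∃ (c : K ≃ₐ[ℚ] K) (ε : (K ≃ₐ[ℚ] K) ≃ ZMod 4 × ZMod 16), σ₀.comp (c : K →+* K) = conjugate σ₀ ∧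
      (∀ g h, ε (g * h) = ε g + ε h) ∧ ε c = (2, 0) := by
  obtain ⟨t, ht, ht1, htb⟩ := exists_quarticUnitTable_eightyFive
  exact exists_quarticAutDatum_of_unitTable t ht ht1 htb σ₀

end Summit.HodgeConjecture.CorCM.FaceQuarticTwist

end
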